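import Mathlib
import HarnessLib
import Summits.HubbardSuperconductivity.HubbardSuperconductivity.Theorems.KLProgrammeKLRegimeEngineV8TwoLegMomentsExportGridIncrements
import Literature.MathematicalPhysics.QuantumLattice.GrassmannDefectSplit

/-!
# Route `KLProgramme` — ENGINE child gen 8 (stmt-HubbardSuperconductivity-20437 `KLRegimeEngineV17F2`), token #23 (GRID two-leg atom, p557865):
# the W3 INTERFACE — the atom from the klScaleWt-weighted masses of the FIXED-FRAME SLICE INCREMENTS of the one-shot grid action
# (cell gate-hubbard-kl, seat hubbard-kl-r2d-p1 g8; companion of `…TwoLegMomentsExportGridIncrements`, p561837)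

Plan g19 (R59ac)(ii) names «W3 = the plain-leg m = 2 read-out pass» (E1 / k3c2-p3 / p3) as the producer of (b)'s 4th conjunct
`TwoLegGridFlowMomentsAt L M (2^10·e¹⁸κ₀⁴·klE3Acum R) (2^11·…) β U μ n`.  `twoLegGridMomentsAt_of_increments` (p561837) converts ANY decomposition of the
pinned two-leg grid kernel with per-scale weighted masses into the atom.  This file fixes THE decomposition W3 works with — the TELESCOPING over the cutoff
ladder AT THE FIXED FRAME `K`: with `W_j[K] := effAction (S_{4M}ᵀ C^K_{>Λ_j} S_{4M}) (V_{4M} + 𝒩_{K,4M})` (the one-shot grid action at cutoff `Λ_j = klScale klE0 j`,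
SAME frame `K` for every `j`),
`kernel₂ (W_n[K] − 𝒩_{K,4M}) = kernel₂ (W_0[K] − 𝒩_{K,4M}) + Σ_{1 ≤ j ≤ n} (kernel₂ W_j[K] − kernel₂ W_{j−1}[K])` (pure algebra, `kernel_sub'`; no partition-function
hypothesis — the semigroup `W_j[K] = effAction (S_{4M}ᵀ C^K_{(Λ_j,Λ_{j−1}]} S_{4M}) W_{j−1}[K]` is only how W3 will BOUND each increment, via
`kernel_effAction_sub_split` + `kernel_grassmannLaplacian`, both generic and in the tree):

* **`twoLegGridMomentsAt_of_sliceIncrementMasses`** — if the scale-`0` pinned kernel has `klScaleWt 0`-weighted mass `≤ m 0` and, for `1 ≤ j ≤ n`, the `j`-th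
  fixed-frame increment has `klScaleWt j`-weighted mass `≤ m j` (both spins, every pin), then `Σ_{j ≤ n} m j/Λ_j ≤ Zt·U²·β/(2N)` and
  `2·Σ_{j ≤ n} m j/Λ_j ≤ Zs·U²·β/(2N)` give `TwoLegGridMomentsAt L M Zt Zs β U μ K n` — so W3 owes exactly: `m j ≤ (β/(2N))·c·U²·Λ_j·g_j` with `Σ_j g_j`
  bounded uniformly in `n` (BGM's `γ^{h}·γ^{ϑh}` for `n_e = 2`).

Proofs only; no definitions; nothing about the model is asserted; nothing asserts superconductivity.
References: BGM 2006 §2.3 (2.17), §3 (3.2)–(3.3) [cite: BenfattoGiulianiMastropietro2006]; Salmhofer 1999 §2.5.1 (2.106) [cite: Salmhofer1999].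
-/

noncomputable section

namespace Summit.HubbardSuperconductivity.HubbardSuperconductivity.Theorems.EngineV8

set_option linter.dupNamespace false -- summit = problem name (single-conjunct summit), D-0017

open Real Finset Literature.MathematicalPhysics.QuantumLattice Literature.Probability.LatticeModels GrassmannAlgebra
open Summit.HubbardSuperconductivity.HubbardSuperconductivity.Theorems.KLProgrammeLegKernels
open Summit.HubbardSuperconductivity.HubbardSuperconductivity.Theorems.KLRegimeSplit

section SliceMasses

variable {L M : ℕ} [NeZero L] [NeZero M]

/-- **THE GRID ATOM FROM THE WEIGHTED MASSES OF THE FIXED-FRAME SLICE INCREMENTS** (any frame `K`, any scale `n`, `0 ≤ β`): with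
`W_j[K] = effAction (S_{4M}ᵀ C^K_{>Λ_j} S_{4M}) (V_{4M} + 𝒩_{K,4M})`, if `Σ_{p₁} klScaleWt 0 {pos p₀, pos p₁}·‖kernel₂ (W_0[K] − 𝒩_{K,4M}) (p₀σ+, p₁σ−)‖ ≤ m 0` and, for
`1 ≤ j ≤ n`, `Σ_{p₁} klScaleWt j {pos p₀, pos p₁}·‖kernel₂ W_j[K] (…) − kernel₂ W_{j−1}[K] (…)‖ ≤ m j` (both spins, every grid pin), then the two budget lines
`Σ_{j ≤ n} m j/Λ_j ≤ Zt·U²·β/(2N)`, `2·Σ_{j ≤ n} m j/Λ_j ≤ Zs·U²·β/(2N)` give `TwoLegGridMomentsAt L M Zt Zs β U μ K n`. -/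
theorem twoLegGridMomentsAt_of_sliceIncrementMasses {β U μ : ℝ} (hβ : 0 ≤ β) {K : TrigPolyC4v} {n : ℕ} {m : ℕ → ℝ} {Zt Zs : ℝ}
    (h0 : ∀ (σ : Fin 2) (p₀ : GridPoint L (2 * (2 * M))), ∑ p₁ : GridPoint L (2 * (2 * M)),
      klScaleWt L M β 0 {((((p₀.1 : ℕ) : ZMod (2 * (2 * M)))), p₀.2), ((((p₁.1 : ℕ) : ZMod (2 * (2 * M)))), p₁.2)} *
        ‖kernel ℂ
          (effAction ℂ ((hubbardGridSub L M β (2 * (2 * M))).transpose *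
              hubbardCovAboveCT L M β μ 0 K (klScale klE0 0) * hubbardGridSub L M β (2 * (2 * M)))
            (hubbardGridInteraction L (2 * (2 * M)) β U + hubbardGridCounterQuadratic L (2 * (2 * M)) β K) -
            hubbardGridCounterQuadratic L (2 * (2 * M)) β K) 2
          (fun i => ((![p₀, p₁] i, σ), i))‖ ≤ m 0)
    (hΔ : ∀ j, 1 ≤ j → j ≤ n → ∀ (σ : Fin 2) (p₀ : GridPoint L (2 * (2 * M))), ∑ p₁ : GridPoint L (2 * (2 * M)),
      klScaleWt L M β j {((((p₀.1 : ℕ) : ZMod (2 * (2 * M)))), p₀.2), ((((p₁.1 : ℕ) : ZMod (2 * (2 * M)))), p₁.2)} *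
        ‖kernel ℂ
            (effAction ℂ ((hubbardGridSub L M β (2 * (2 * M))).transpose *
                hubbardCovAboveCT L M β μ 0 K (klScale klE0 j) * hubbardGridSub L M β (2 * (2 * M)))
              (hubbardGridInteraction L (2 * (2 * M)) β U + hubbardGridCounterQuadratic L (2 * (2 * M)) β K)) 2
            (fun i => ((![p₀, p₁] i, σ), i)) -
          kernel ℂ
            (effAction ℂ ((hubbardGridSub L M β (2 * (2 * M))).transpose *
                hubbardCovAboveCT L M β μ 0 K (klScale klE0 (j - 1)) * hubbardGridSub L M β (2 * (2 * M)))
              (hubbardGridInteraction L (2 * (2 * M)) β U + hubbardGridCounterQuadratic L (2 * (2 * M)) β K)) 2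
            (fun i => ((![p₀, p₁] i, σ), i))‖ ≤ m j)
    (hZt : ∑ j ∈ range (n + 1), m j / klScale klE0 j ≤ Zt * U ^ 2 * (β / (2 * ((2 * (2 * M) : ℕ) : ℝ))))
    (hZs : 2 * ∑ j ∈ range (n + 1), m j / klScale klE0 j ≤ Zs * U ^ 2 * (β / (2 * ((2 * (2 * M) : ℕ) : ℝ)))) :
    TwoLegGridMomentsAt L M Zt Zs β U μ K n := by
  -- abbreviations: the pinned two-leg kernel of `W_j[K]` and of the grid counterterm
  set k : ℕ → Fin 2 → GridPoint L (2 * (2 * M)) → GridPoint L (2 * (2 * M)) → ℂ := fun j σ p₀ p₁ =>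
    kernel ℂ
      (effAction ℂ ((hubbardGridSub L M β (2 * (2 * M))).transpose *
          hubbardCovAboveCT L M β μ 0 K (klScale klE0 j) * hubbardGridSub L M β (2 * (2 * M)))
        (hubbardGridInteraction L (2 * (2 * M)) β U + hubbardGridCounterQuadratic L (2 * (2 * M)) β K)) 2
      (fun i => ((![p₀, p₁] i, σ), i)) with hk
  set c : Fin 2 → GridPoint L (2 * (2 * M)) → GridPoint L (2 * (2 * M)) → ℂ := fun σ p₀ p₁ =>
    kernel ℂ (hubbardGridCounterQuadratic L (2 * (2 * M)) β K) 2 (fun i => ((![p₀, p₁] i, σ), i)) with hc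
  -- the telescoping decomposition
  let Δ : ℕ → Fin 2 → GridPoint L (2 * (2 * M)) → GridPoint L (2 * (2 * M)) → ℂ := fun j σ p₀ p₁ =>
    if j = 0 then k 0 σ p₀ p₁ - c σ p₀ p₁ else k j σ p₀ p₁ - k (j - 1) σ p₀ p₁
  have htel : ∀ (N : ℕ) (σ : Fin 2) (p₀ p₁ : GridPoint L (2 * (2 * M))),
      ∑ j ∈ range (N + 1), Δ j σ p₀ p₁ = k N σ p₀ p₁ - c σ p₀ p₁ := by
    intro N σ p₀ p₁
    induction N with
    | zero => simp [Δ]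
    | succ N ih =>
      rw [sum_range_succ, ih]
      simp only [Δ, Nat.succ_ne_zero, if_false, Nat.add_sub_cancel]
      ring
  refine twoLegGridMomentsAt_of_increments hβ Δ (m := m) (fun σ p₀ p₁ => ?_) (fun j hj σ p₀ => ?_) hZt hZs
  · -- `kernel₂ (W_n[K] − 𝒩) = Σ_{j ≤ n} Δ_j`
    rw [htel n σ p₀ p₁, kernel_sub']
  · -- the weighted masses, scale by scale
    rcases Nat.eq_zero_or_pos j with rfl | hj1
    · refine le_trans (le_of_eq (sum_congr rfl fun p₁ _ => ?_)) (h0 σ p₀)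
      simp only [Δ, if_true, hk, hc, kernel_sub']
    · refine le_trans (le_of_eq (sum_congr rfl fun p₁ _ => ?_)) (hΔ j hj1 hj σ p₀)
      simp only [Δ, Nat.pos_iff_ne_zero.1 hj1, if_false, hk]

end SliceMasses

end Summit.HubbardSuperconductivity.HubbardSuperconductivity.Theorems.EngineV8

end
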